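import Mathlib.Tactic
import HarnessLib
import HarnessLib.Audit.Tags
import Summits.CriticalPhenomena.PercolationContinuityZ3.Theorems.PercNearOneGluingNoHeavyLowerTailSahiAntichainBlowupMeets
import Summits.CriticalPhenomena.PercolationContinuityZ3.Theorems.PercNearOneGluingNoHeavyLowerTailSahiAntichainSplitSix

/-!
# Antichains, meets plus joins: **the blow-up side lemma** — a `C([4],2)` blow-up side creates four new labels

Support file (seat `prim-masterthm-p1`, gen 38; `--supports stmt-CriticalPhenomena-4575`).  No `sorry`, no new definitions, standard
axioms.  Memo `run/shared/lean/prim/prim-masterthm/FROM-prim-masterthm-p1-g38-BLOWUP-SIDE.md` §3.  Completes `…BlowupJoins`,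
`…BlowupMeets`.

MAIN RESULT ([this work], gen 38): `four_le_newLabels_of_blowup` — if `above P r = {K ∪ B i ∪ B j : i ≠ j}` for a set `K ∋ r` and four
non-empty blocks, pairwise disjoint and disjoint from `K`, and some member of the antichain `P` avoids `r`, then `newLabels P r ≥ 4`
(tight: against the aligned four-member co-sunflower `{β ∪ ⋃_{i ≠ m} B i}` exactly the four one-block meets `β ∪ B i` are new).
This is the `C([4],2)`-side half of **L4**; with the structure theorem for six-member antichains with at most eleven labels (to come)
it gives L4 and hence V5 (`two_mul_card_le_of_L4`, `…TwoThreeA`).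

PROOF (case analysis on the members below by whole / met / missed blocks; all sub-lemmas in the three files):
* a member with a point outside `K ∪ ⋃ B` and at most two whole blocks, or inside with at most one whole block: four new joins
  (`…BlowupJoins`);
* otherwise regime (R): two whole and one or two partial blocks: two new joins and two new meets, resp. three and one (`…BlowupMeets`);
* otherwise every member below has at least three whole blocks (regime (R3), this file): cross meets with at most one whole block are
  new (`inter_mem_newMeets_of_regime3`), a member with exactly three whole blocks gives three of them plus a fourth label
  (`four_le_newLabels_of_three_whole`, using `exists_whole_missing_of_two_block_old` for an old two-block meet), and if every member
  below contains all four blocks, four two-block cross meets are new (`four_le_card_newMeets_of_all_whole`).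
HONEST FRAMING: unconditional; L4 and V5 remain OPEN until the structure theorem lands. [this work]
-/

namespace Summit.CriticalPhenomena.PercolationContinuityZ3.Theorems.SahiColouredDaykin

open Finset

variable {α : Type*} [DecidableEq α]

section Blowup

variable {P : Finset (Finset α)} {r : α} {K : Finset α} {B : Fin 4 → Finset α}

/-! ### 1. Regime (R3): every member below has at most one non-whole block -/

/-- (R3) implies (R). [this work] -/
theorem regime_of_regime3 (hR3 : ∀ d ∈ below P r, ∀ u v : Fin 4, u ≠ v → B u ⊆ d ∨ B v ⊆ d) :
    ∀ d ∈ below P r, (∀ t u v : Fin 4, t ≠ u → t ≠ v → u ≠ v → B t ⊆ d ∨ B u ⊆ d ∨ B v ⊆ d) ∧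
      (¬ d ⊆ K ∪ Finset.univ.biUnion B → ∀ u v : Fin 4, u ≠ v → B u ⊆ d ∨ B v ⊆ d) := by
  intro d hd
  refine ⟨fun t u v htu _ _ => ?_, fun _ u v huv => hR3 d hd u v huv⟩
  rcases hR3 d hd t u htu with h | h
  · exact Or.inl h
  · exact Or.inr (Or.inl h)

/-- **(M4)** Under (R3), a cross meet with three non-whole blocks is new (old meets contain two whole blocks among any three). [this work] -/
theorem inter_mem_newMeets_of_regime3 (hA : ∀ a, a ∈ above P r ↔ ∃ i j, i ≠ j ∧ a = K ∪ B i ∪ B j)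
    (hR3 : ∀ d ∈ below P r, ∀ u v : Fin 4, u ≠ v → B u ⊆ d ∨ B v ⊆ d)
    {b : Finset α} (hb : b ∈ below P r) {i j : Fin 4} (hij : i ≠ j) {m₁ m₂ m₃ : Fin 4}
    (h12 : m₁ ≠ m₂) (h13 : m₁ ≠ m₃) (h23 : m₂ ≠ m₃)
    (n₁ : ¬ B m₁ ⊆ (K ∪ B i ∪ B j) ∩ b) (n₂ : ¬ B m₂ ⊆ (K ∪ B i ∪ B j) ∩ b) (n₃ : ¬ B m₃ ⊆ (K ∪ B i ∪ B j) ∩ b) :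
    (K ∪ B i ∪ B j) ∩ b ∈ newMeets P r := by
  rw [inter_mem_newMeets_iff (blowup_mem_above hA hij) hb]
  intro hold
  obtain ⟨d, hd, d', hd', _, heq⟩ := mem_meets_iff.1 hold
  have both : ∀ {m : Fin 4}, ¬ B m ⊆ (K ∪ B i ∪ B j) ∩ b → B m ⊆ d → B m ⊆ d' → False :=
    fun hn h h' => hn (by rw [heq]; exact subset_inter h h')
  rcases hR3 d hd m₁ m₂ h12 with h1 | h2
  · rcases hR3 d' hd' m₁ m₂ h12 with h1' | h2'
    · exact both n₁ h1 h1'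
    · rcases hR3 d hd m₂ m₃ h23 with h2 | h3
      · exact both n₂ h2 h2'
      · rcases hR3 d' hd' m₁ m₃ h13 with h1' | h3'
        · exact both n₁ h1 h1'
        · exact both n₃ h3 h3'
  · rcases hR3 d' hd' m₁ m₂ h12 with h1' | h2'
    · rcases hR3 d hd m₁ m₃ h13 with h1 | h3
      · exact both n₁ h1 h1'
      · rcases hR3 d' hd' m₂ m₃ h23 with h2' | h3'
        · exact both n₂ h2 h2'
        · exact both n₃ h3 h3'
    · exact both n₂ h2 h2'

omit [DecidableEq α] in
/-- A block without points in a set is not contained in it. [this work] -/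
theorem not_block_subset_of_forall_not_mem (hne : ∀ i, (B i).Nonempty) {m : Fin 4} {Z : Finset α}
    (h : ∀ x ∈ B m, x ∉ Z) : ¬ B m ⊆ Z := by
  obtain ⟨x, hx⟩ := hne m
  exact fun hs => h x hx (hs hx)

/-- A block outside the pair `{i, j}` has no point in the cross meet `(K ∪ B i ∪ B j) ∩ b`. [this work] -/
theorem not_mem_inter_of_ne (hdis : ∀ i j, i ≠ j → Disjoint (B i) (B j)) (hKB : ∀ i, Disjoint K (B i))
    {b : Finset α} {i j m : Fin 4} (hmi : m ≠ i) (hmj : m ≠ j) {x : α} (hx : x ∈ B m) : x ∉ (K ∪ B i ∪ B j) ∩ b := by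
  intro h
  rcases (mem_blowup_member_iff hdis hKB hx).1 (mem_inter.1 h).1 with rfl | rfl
  · exact hmi rfl
  · exact hmj rfl

/-- **(M5)** Under (R3): if `b` contains blocks `s, t` and the two-block cross meet `(K ∪ B s ∪ B t) ∩ b` is OLD, then some member below
contains block `v` and misses block `u` (for the other two blocks `u, v`). [this work] -/
theorem exists_whole_missing_of_two_block_old (hA : ∀ a, a ∈ above P r ↔ ∃ i j, i ≠ j ∧ a = K ∪ B i ∪ B j)
    (hdis : ∀ i j, i ≠ j → Disjoint (B i) (B j)) (hKB : ∀ i, Disjoint K (B i)) (hne : ∀ i, (B i).Nonempty)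
    (hR3 : ∀ d ∈ below P r, ∀ u v : Fin 4, u ≠ v → B u ⊆ d ∨ B v ⊆ d)
    {b : Finset α} (hb : b ∈ below P r) {s t u v : Fin 4} (hst : s ≠ t) (hsu : s ≠ u) (hsv : s ≠ v) (htu : t ≠ u) (htv : t ≠ v)
    (huv : u ≠ v) (hold : (K ∪ B s ∪ B t) ∩ b ∉ newMeets P r) :
    ∃ d ∈ below P r, B v ⊆ d ∧ B u ∩ d = ∅ := by
  rw [inter_mem_newMeets_iff (blowup_mem_above hA hst) hb, not_not] at hold
  obtain ⟨d, hd, d', hd', _, heq⟩ := mem_meets_iff.1 hold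
  -- blocks `u, v` have no point in both `d` and `d'`
  have E : ∀ {m : Fin 4}, m ≠ s → m ≠ t → ∀ {y : α}, y ∈ B m → y ∈ d → y ∈ d' → False := by
    intro m hms hmt y hy hyd hyd'
    have : y ∈ (K ∪ B s ∪ B t) ∩ b := by rw [heq]; exact mem_inter.2 ⟨hyd, hyd'⟩
    exact not_mem_inter_of_ne hdis hKB hms hmt hy this
  have empR : ∀ {m : Fin 4}, m ≠ s → m ≠ t → B m ⊆ d → B m ∩ d' = ∅ := by
    intro m hms hmt h
    apply eq_empty_of_forall_notMem; intro y hy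
    obtain ⟨hy1, hy2⟩ := mem_inter.1 hy
    exact E hms hmt hy1 (h hy1) hy2
  have empL : ∀ {m : Fin 4}, m ≠ s → m ≠ t → B m ⊆ d' → B m ∩ d = ∅ := by
    intro m hms hmt h
    apply eq_empty_of_forall_notMem; intro y hy
    obtain ⟨hy1, hy2⟩ := mem_inter.1 hy
    exact E hms hmt hy1 hy2 (h hy1)
  rcases hR3 d hd u v huv with hu | hv
  · have e' := empR hsu.symm htu.symm hu
    rcases hR3 d' hd' u v huv with hu' | hv'
    · exact absurd e' (inter_ne_empty_of_subset hne hu')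
    · exact ⟨d', hd', hv', e'⟩
  · have e' := empR hsv.symm htv.symm hv
    rcases hR3 d' hd' u v huv with hu' | hv'
    · exact ⟨d, hd, hv, empL hsu.symm htu.symm hu'⟩
    · exact absurd e' (inter_ne_empty_of_subset hne hv')

/-! ### 2. Regime (R3): the assembly -/

/-- **Three whole blocks.**  Under (R3), a member `b` below containing blocks `s, t` (and `u`) but not `v` yields `newLabels ≥ 4`: the three
one-whole-block cross meets `(K ∪ B m ∪ B v) ∩ b` (`m = s, t, u`) are new, and a fourth label is the join `(K ∪ B s ∪ B t) ∪ b` (if `b`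
leaves the ground or meets `B v`), or the two-block meet `(K ∪ B s ∪ B t) ∩ b` (if new), or — if that one is old — the one-block meet
through a member containing `B v` and missing `B u` (M5). [this work] -/
theorem four_le_newLabels_of_three_whole (hA : ∀ a, a ∈ above P r ↔ ∃ i j, i ≠ j ∧ a = K ∪ B i ∪ B j)
    (hdis : ∀ i j, i ≠ j → Disjoint (B i) (B j)) (hKB : ∀ i, Disjoint K (B i)) (hne : ∀ i, (B i).Nonempty)
    (hR3 : ∀ d ∈ below P r, ∀ u v : Fin 4, u ≠ v → B u ⊆ d ∨ B v ⊆ d)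
    {b : Finset α} (hb : b ∈ below P r) {s t u v : Fin 4} (hst : s ≠ t) (hsu : s ≠ u) (hsv : s ≠ v) (htu : t ≠ u) (htv : t ≠ v)
    (huv : u ≠ v) (hs : B s ⊆ b) (ht : B t ⊆ b) (hv : ¬ B v ⊆ b) : 4 ≤ newLabels P r := by
  -- the one-whole-block meets are new and pairwise distinct
  have nv : ∀ {m : Fin 4}, m ≠ v → ¬ B v ⊆ (K ∪ B m ∪ B v) ∩ b := fun _ h => hv (h.trans inter_subset_right)
  have nw : ∀ {m m' : Fin 4}, m' ≠ m → m' ≠ v → ¬ B m' ⊆ (K ∪ B m ∪ B v) ∩ b :=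
    fun h1 h2 => not_block_subset_of_forall_not_mem hne fun x hx => not_mem_inter_of_ne hdis hKB h1 h2 hx
  have Zs := inter_mem_newMeets_of_regime3 hA hR3 hb hsv htu htv huv (nw hst.symm htv) (nw hsu.symm huv) (nv hsv)
  have Zt := inter_mem_newMeets_of_regime3 hA hR3 hb htv hsu hsv huv (nw hst hsv) (nw htu.symm huv) (nv htv)
  have Zu := inter_mem_newMeets_of_regime3 hA hR3 hb huv hst hsv htv (nw hsu hsv) (nw htu htv) (nv huv)
  -- a whole block `m ⊆ b` lies in its own one-block meet and in no other
  have mem_own : ∀ {m : Fin 4} {x : α}, x ∈ B m → B m ⊆ b → x ∈ (K ∪ B m ∪ B v) ∩ b :=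
    fun hx hm => mem_inter.2 ⟨mem_union_left _ (mem_union_right _ hx), hm hx⟩
  obtain ⟨xs, hxs⟩ := hne s
  obtain ⟨xt, hxt⟩ := hne t
  have st : (K ∪ B s ∪ B v) ∩ b ≠ (K ∪ B t ∪ B v) ∩ b := fun h =>
    not_mem_inter_of_ne hdis hKB hst hsv hxs (h ▸ mem_own hxs hs)
  have su : (K ∪ B s ∪ B v) ∩ b ≠ (K ∪ B u ∪ B v) ∩ b := fun h =>
    not_mem_inter_of_ne hdis hKB hsu hsv hxs (h ▸ mem_own hxs hs)
  have tu : (K ∪ B t ∪ B v) ∩ b ≠ (K ∪ B u ∪ B v) ∩ b := fun h =>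
    not_mem_inter_of_ne hdis hKB htu htv hxt (h ▸ mem_own hxt ht)
  have h3 : 3 ≤ #(newMeets P r) := three_le_card_of_mem Zs Zt Zu st su tu
  unfold newLabels
  by_cases hbG : b ⊆ K ∪ Finset.univ.biUnion B
  · by_cases hvb : B v ∩ b = ∅
    · -- `b` misses `B v`: fourth label among the meets
      by_cases hnew : (K ∪ B s ∪ B t) ∩ b ∈ newMeets P r
      · have d1 : (K ∪ B s ∪ B t) ∩ b ≠ (K ∪ B s ∪ B v) ∩ b := fun h =>
          not_mem_inter_of_ne hdis hKB hst.symm htv hxt (h ▸ mem_inter.2 ⟨mem_union_right _ hxt, ht hxt⟩)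
        have d2 : (K ∪ B s ∪ B t) ∩ b ≠ (K ∪ B t ∪ B v) ∩ b := fun h =>
          not_mem_inter_of_ne hdis hKB hst hsv hxs (h ▸ mem_inter.2 ⟨mem_union_left _ (mem_union_right _ hxs), hs hxs⟩)
        have d3 : (K ∪ B s ∪ B t) ∩ b ≠ (K ∪ B u ∪ B v) ∩ b := fun h =>
          not_mem_inter_of_ne hdis hKB hsu hsv hxs (h ▸ mem_inter.2 ⟨mem_union_left _ (mem_union_right _ hxs), hs hxs⟩)
        have := four_le_card_of_mem hnew Zs Zt Zu d1 d2 d3 st su tu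
        omega
      · obtain ⟨d, hd, hvd, hud⟩ := exists_whole_missing_of_two_block_old hA hdis hKB hne hR3 hb hst hsu hsv htu htv huv hnew
        -- the one-block meet `(K ∪ B v ∪ B u) ∩ d` is new and contains `B v`, unlike the three meets inside `b`
        have Zv : (K ∪ B v ∪ B u) ∩ d ∈ newMeets P r :=
          inter_mem_newMeets_of_regime3 hA hR3 hd huv.symm hst hsu htu
            (not_block_subset_of_forall_not_mem hne fun x hx => not_mem_inter_of_ne hdis hKB hsv hsu hx)
            (not_block_subset_of_forall_not_mem hne fun x hx => not_mem_inter_of_ne hdis hKB htv htu hx)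
            (not_block_subset_of_forall_not_mem hne fun x hx h => by
              have : x ∈ B u ∩ d := mem_inter.2 ⟨hx, (mem_inter.1 h).2⟩
              rw [hud] at this; exact notMem_empty _ this)
        obtain ⟨xv, hxv⟩ := hne v
        have hin : xv ∈ (K ∪ B v ∪ B u) ∩ d := mem_inter.2 ⟨mem_union_left _ (mem_union_right _ hxv), hvd hxv⟩
        have nvb : ∀ {m : Fin 4}, xv ∉ (K ∪ B m ∪ B v) ∩ b := fun h => by
          have : xv ∈ B v ∩ b := mem_inter.2 ⟨hxv, (mem_inter.1 h).2⟩
          rw [hvb] at this; exact notMem_empty _ this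
        have e1 : (K ∪ B v ∪ B u) ∩ d ≠ (K ∪ B s ∪ B v) ∩ b := fun h => nvb (h ▸ hin)
        have e2 : (K ∪ B v ∪ B u) ∩ d ≠ (K ∪ B t ∪ B v) ∩ b := fun h => nvb (h ▸ hin)
        have e3 : (K ∪ B v ∪ B u) ∩ d ≠ (K ∪ B u ∪ B v) ∩ b := fun h => nvb (h ▸ hin)
        have := four_le_card_of_mem Zv Zs Zt Zu e1 e2 e3 st su tu
        omega
    · -- `b` meets `B v` partially: the join over `{s,t}` is new
      obtain ⟨x, hx⟩ := nonempty_iff_ne_empty.2 hvb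
      obtain ⟨hxv, hxb⟩ := mem_inter.1 hx
      have J := union_mem_newJoins_of_partial hA hdis hKB hb hst hsv.symm htv.symm hxv hxb hv
      have : 1 ≤ #(newJoins P r) := card_pos.2 ⟨_, J⟩
      omega
  · have J := union_mem_newJoins_of_not_subset_ground hA hb hbG hst
    have : 1 ≤ #(newJoins P r) := card_pos.2 ⟨_, J⟩
    omega

/-- **All blocks whole everywhere below.**  If every member below contains all four blocks, the four cross meets of `b` with the
members `{0,1}, {0,2}, {0,3}, {1,2}` are new (an old meet contains every block) and pairwise distinct. [this work] -/
theorem four_le_card_newMeets_of_all_whole (hA : ∀ a, a ∈ above P r ↔ ∃ i j, i ≠ j ∧ a = K ∪ B i ∪ B j)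
    (hdis : ∀ i j, i ≠ j → Disjoint (B i) (B j)) (hKB : ∀ i, Disjoint K (B i)) (hne : ∀ i, (B i).Nonempty)
    (hall : ∀ d ∈ below P r, ∀ m, B m ⊆ d) {b : Finset α} (hb : b ∈ below P r) : 4 ≤ #(newMeets P r) := by
  have nw : ∀ {i j m : Fin 4}, m ≠ i → m ≠ j → ¬ B m ⊆ (K ∪ B i ∪ B j) ∩ b :=
    fun h1 h2 => not_block_subset_of_forall_not_mem hne fun x hx => not_mem_inter_of_ne hdis hKB h1 h2 hx
  -- new: an old meet contains every block, a two-block cross meet misses the other blocks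
  have newm : ∀ {i j k : Fin 4}, i ≠ j → k ≠ i → k ≠ j → (K ∪ B i ∪ B j) ∩ b ∈ newMeets P r := by
    intro i j k hij hki hkj
    rw [inter_mem_newMeets_iff (blowup_mem_above hA hij) hb]
    intro hold
    obtain ⟨d, hd, d', hd', _, heq⟩ := mem_meets_iff.1 hold
    exact nw hki hkj (by rw [heq]; exact subset_inter (hall d hd k) (hall d' hd' k))
  have Z01 := newm (i := 0) (j := 1) (k := 2) (by decide) (by decide) (by decide)
  have Z02 := newm (i := 0) (j := 2) (k := 1) (by decide) (by decide) (by decide)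
  have Z03 := newm (i := 0) (j := 3) (k := 1) (by decide) (by decide) (by decide)
  have Z12 := newm (i := 1) (j := 2) (k := 0) (by decide) (by decide) (by decide)
  -- distinctness by block points inside `b`
  have pt : ∀ {i j m : Fin 4} {x : α}, x ∈ B m → m = i ∨ m = j → x ∈ (K ∪ B i ∪ B j) ∩ b :=
    fun hx hm => mem_inter.2 ⟨(mem_blowup_member_iff hdis hKB hx).2 hm, hall b hb _ hx⟩
  obtain ⟨x1, hx1⟩ := hne 1
  obtain ⟨x2, hx2⟩ := hne 2
  obtain ⟨x3, hx3⟩ := hne 3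
  refine four_le_card_of_mem Z01 Z02 Z03 Z12 ?_ ?_ ?_ ?_ ?_ ?_
  · exact fun h => not_mem_inter_of_ne hdis hKB (by decide) (by decide) hx1 (h ▸ pt hx1 (Or.inr rfl))
  · exact fun h => not_mem_inter_of_ne hdis hKB (by decide) (by decide) hx1 (h ▸ pt hx1 (Or.inr rfl))
  · exact fun h => not_mem_inter_of_ne hdis hKB (by decide) (by decide) hx2 (h.symm ▸ pt hx2 (Or.inr rfl))
  · exact fun h => not_mem_inter_of_ne hdis hKB (by decide) (by decide) hx2 (h ▸ pt hx2 (Or.inr rfl))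
  · exact fun h => not_mem_inter_of_ne hdis hKB (by decide) (by decide) hx1 (h.symm ▸ pt hx1 (Or.inl rfl))
  · exact fun h => not_mem_inter_of_ne hdis hKB (by decide) (by decide) hx3 (h ▸ pt hx3 (Or.inr rfl))

/-! ### 3. Regime (R): two whole blocks and one or two partial ones -/

/-- **Two whole blocks, one partial, one missed** (under (R)): two new meets and two new joins. [this work] -/
theorem four_le_newLabels_of_one_partial (hanti : IsAntichain (· ⊆ ·) (P : Set (Finset α)))
    (hA : ∀ a, a ∈ above P r ↔ ∃ i j, i ≠ j ∧ a = K ∪ B i ∪ B j)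
    (hdis : ∀ i j, i ≠ j → Disjoint (B i) (B j)) (hKB : ∀ i, Disjoint K (B i)) (hne : ∀ i, (B i).Nonempty) (hr : r ∈ K)
    (hR : ∀ d ∈ below P r, (∀ t u v : Fin 4, t ≠ u → t ≠ v → u ≠ v → B t ⊆ d ∨ B u ⊆ d ∨ B v ⊆ d) ∧
      (¬ d ⊆ K ∪ Finset.univ.biUnion B → ∀ u v : Fin 4, u ≠ v → B u ⊆ d ∨ B v ⊆ d))
    {b : Finset α} (hb : b ∈ below P r) {s t u v : Fin 4} (hst : s ≠ t) (hsu : s ≠ u) (hsv : s ≠ v) (htu : t ≠ u) (htv : t ≠ v)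
    (huv : u ≠ v) (hs : B s ⊆ b) (hu : ¬ B u ⊆ b) (hu' : (B u ∩ b).Nonempty) (hv : B v ∩ b = ∅) :
    4 ≤ newLabels P r := by
  have nv : ¬ B v ⊆ b := fun h => inter_ne_empty_of_subset hne h hv
  -- two new joins
  obtain ⟨x, hx⟩ := hu'
  obtain ⟨hxu, hxb⟩ := mem_inter.1 hx
  have J1 := union_mem_newJoins_of_partial hA hdis hKB hb hst hsu.symm htu.symm hxu hxb hu
  have J2 := union_mem_newJoins_of_partial hA hdis hKB hb hsv hsu.symm huv hxu hxb hu
  have hJ : 2 ≤ #(newJoins P r) :=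
    two_le_card_of_mem J2 J1 (union_ne_union_of_not_block_subset hdis hKB (Or.inr rfl) hsv.symm htv.symm nv)
  -- two new meets
  have Z1 := inter_mem_newMeets_of_single_partial hanti hA hdis hKB hne hr hR hb huv hv hu
  have hM : 2 ≤ #(newMeets P r) := by
    by_cases hZ2 : (K ∪ B s ∪ B v) ∩ b ∈ newMeets P r
    · obtain ⟨y, hy⟩ := hne s
      refine two_le_card_of_mem hZ2 Z1 fun h => ?_
      have hy' : y ∈ (K ∪ B u ∪ B v) ∩ b := by
        rw [← h]; exact mem_inter.2 ⟨mem_union_left _ (mem_union_right _ hy), hs hy⟩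
      exact not_mem_inter_of_ne hdis hKB hsu hsv hy hy'
    · obtain ⟨Z₁, h₁, Z₂, h₂, hne'⟩ := two_newMeets_of_whole_block_old hanti hA hdis hKB hne hr hR hb hsv hv hZ2
      exact two_le_card_of_mem h₁ h₂ hne'
  unfold newLabels; omega

/-- **Two whole blocks, two partial** (under (R)): three new joins and a new meet. [this work] -/
theorem four_le_newLabels_of_two_partial (hanti : IsAntichain (· ⊆ ·) (P : Set (Finset α)))
    (hA : ∀ a, a ∈ above P r ↔ ∃ i j, i ≠ j ∧ a = K ∪ B i ∪ B j)
    (hdis : ∀ i j, i ≠ j → Disjoint (B i) (B j)) (hKB : ∀ i, Disjoint K (B i)) (hne : ∀ i, (B i).Nonempty) (hr : r ∈ K)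
    (hR : ∀ d ∈ below P r, (∀ t u v : Fin 4, t ≠ u → t ≠ v → u ≠ v → B t ⊆ d ∨ B u ⊆ d ∨ B v ⊆ d) ∧
      (¬ d ⊆ K ∪ Finset.univ.biUnion B → ∀ u v : Fin 4, u ≠ v → B u ⊆ d ∨ B v ⊆ d))
    {b : Finset α} (hb : b ∈ below P r) {s t u v : Fin 4} (hst : s ≠ t) (hsu : s ≠ u) (hsv : s ≠ v) (htu : t ≠ u) (htv : t ≠ v)
    (huv : u ≠ v) (hu : ¬ B u ⊆ b) (hv : ¬ B v ⊆ b) (hu' : (B u ∩ b).Nonempty) (hv' : (B v ∩ b).Nonempty) :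
    4 ≤ newLabels P r := by
  have hM : 1 ≤ #(newMeets P r) :=
    card_pos.2 (newMeets_nonempty_of_two_partial hanti hA hdis hKB hne hr hR hb hst hsu hsv htu htv huv hu hv hu' hv')
  obtain ⟨x, hx⟩ := hu'
  obtain ⟨hxu, hxb⟩ := mem_inter.1 hx
  obtain ⟨y, hy⟩ := hv'
  obtain ⟨hyv, hyb⟩ := mem_inter.1 hy
  have J1 := union_mem_newJoins_of_partial hA hdis hKB hb hst hsu.symm htu.symm hxu hxb hu
  have J2 := union_mem_newJoins_of_partial hA hdis hKB hb hsu hsv.symm huv.symm hyv hyb hv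
  have J3 := union_mem_newJoins_of_partial hA hdis hKB hb hsv hsu.symm huv hxu hxb hu
  have hJ : 3 ≤ #(newJoins P r) := by
    refine three_le_card_of_mem J1 J2 J3 ?_ ?_ ?_
    · exact (union_ne_union_of_not_block_subset hdis hKB (Or.inr rfl) hsu.symm htu.symm hu).symm
    · exact (union_ne_union_of_not_block_subset hdis hKB (Or.inr rfl) hsv.symm htv.symm hv).symm
    · exact union_ne_union_of_not_block_subset hdis hKB (Or.inr rfl) hsu.symm huv hu
  unfold newLabels; omega

/-! ### 4. The blow-up side lemma -/

/-- **THE BLOW-UP SIDE LEMMA.**  If the members containing `r` are exactly the six sets `K ∪ B i ∪ B j` (`i ≠ j`) for `K ∋ r` and four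
non-empty blocks, pairwise disjoint and disjoint from `K`, and some member of the antichain avoids `r`, then `newLabels P r ≥ 4`. [this work] -/
theorem four_le_newLabels_of_blowup (hanti : IsAntichain (· ⊆ ·) (P : Set (Finset α)))
    (hA : ∀ a, a ∈ above P r ↔ ∃ i j, i ≠ j ∧ a = K ∪ B i ∪ B j)
    (hdis : ∀ i j, i ≠ j → Disjoint (B i) (B j)) (hKB : ∀ i, Disjoint K (B i)) (hne : ∀ i, (B i).Nonempty) (hr : r ∈ K)
    (hB : (below P r).Nonempty) : 4 ≤ newLabels P r := by
  -- Case I: a join-rich member below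
  by_cases hI : ∃ b ∈ below P r, (¬ b ⊆ K ∪ Finset.univ.biUnion B ∧ ∃ u v : Fin 4, u ≠ v ∧ ¬ B u ⊆ b ∧ ¬ B v ⊆ b) ∨
      (b ⊆ K ∪ Finset.univ.biUnion B ∧ ∃ t u v : Fin 4, t ≠ u ∧ t ≠ v ∧ u ≠ v ∧ ¬ B t ⊆ b ∧ ¬ B u ⊆ b ∧ ¬ B v ⊆ b)
  · obtain ⟨b, hb, h⟩ := hI
    unfold newLabels
    rcases h with ⟨hbG, u, v, huv, hu, hv⟩ | ⟨hbG, t, u, v, htu, htv, huv, ht, hu, hv⟩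
    · have := four_le_card_newJoins_of_outside hA hdis hKB hb hbG huv hu hv; omega
    · have := four_le_card_newJoins_of_inside hanti hA hdis hKB hr hb hbG htu htv huv ht hu hv; omega
  -- otherwise regime (R)
  have hR : ∀ d ∈ below P r, (∀ t u v : Fin 4, t ≠ u → t ≠ v → u ≠ v → B t ⊆ d ∨ B u ⊆ d ∨ B v ⊆ d) ∧
      (¬ d ⊆ K ∪ Finset.univ.biUnion B → ∀ u v : Fin 4, u ≠ v → B u ⊆ d ∨ B v ⊆ d) := by
    intro d hd
    constructor
    · intro t u v htu htv huv
      by_contra h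
      simp only [not_or] at h
      apply hI
      by_cases hdG : d ⊆ K ∪ Finset.univ.biUnion B
      · exact ⟨d, hd, Or.inr ⟨hdG, t, u, v, htu, htv, huv, h.1, h.2.1, h.2.2⟩⟩
      · exact ⟨d, hd, Or.inl ⟨hdG, t, u, htu, h.1, h.2.1⟩⟩
    · intro hdG u v huv
      by_contra h
      simp only [not_or] at h
      exact hI ⟨d, hd, Or.inl ⟨hdG, u, v, huv, h.1, h.2⟩⟩
  by_cases h2 : ∃ b ∈ below P r, ∃ u v : Fin 4, u ≠ v ∧ ¬ B u ⊆ b ∧ ¬ B v ⊆ b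
  · -- exactly two whole blocks
    obtain ⟨b, hb, u, v, huv, hu, hv⟩ := h2
    obtain ⟨s, t, hst, hsu, hsv, htu, htv⟩ := fin4_exists_other_two huv
    have hs : B s ⊆ b := by
      rcases (hR b hb).1 s u v hsu hsv huv with h | h | h
      · exact h
      · exact absurd h hu
      · exact absurd h hv
    have ht : B t ⊆ b := by
      rcases (hR b hb).1 t u v htu htv huv with h | h | h
      · exact h
      · exact absurd h hu
      · exact absurd h hv
    by_cases hbu : B u ∩ b = ∅
    · have hv' := touches_of_regime hanti hA hne hr hR hb huv hbu
      exact four_le_newLabels_of_one_partial hanti hA hdis hKB hne hr hR hb hst hsv hsu htv htu huv.symm hs hv hv' hbu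
    · have hu' : (B u ∩ b).Nonempty := nonempty_iff_ne_empty.2 hbu
      by_cases hbv : B v ∩ b = ∅
      · exact four_le_newLabels_of_one_partial hanti hA hdis hKB hne hr hR hb hst hsu hsv htu htv huv hs hu hu' hbv
      · exact four_le_newLabels_of_two_partial hanti hA hdis hKB hne hr hR hb hst hsu hsv htu htv huv hu hv hu'
          (nonempty_iff_ne_empty.2 hbv)
  -- otherwise regime (R3)
  have hR3 : ∀ d ∈ below P r, ∀ u v : Fin 4, u ≠ v → B u ⊆ d ∨ B v ⊆ d := by
    intro d hd u v huv
    by_contra h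
    simp only [not_or] at h
    exact h2 ⟨d, hd, u, v, huv, h.1, h.2⟩
  obtain ⟨b₀, hb₀⟩ := hB
  by_cases hall : ∀ d ∈ below P r, ∀ m, B m ⊆ d
  · have := four_le_card_newMeets_of_all_whole hA hdis hKB hne hall hb₀
    unfold newLabels; omega
  · simp only [not_forall] at hall
    obtain ⟨b, hb, v, hv⟩ := hall
    obtain ⟨s, t, u, hst, hsu, htu, hsv, htv, huv⟩ := fin4_exists_three_others v
    have whole : ∀ {m : Fin 4}, m ≠ v → B m ⊆ b := by
      intro m hmv
      rcases hR3 b hb m v hmv with h | h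
      · exact h
      · exact absurd h hv
    exact four_le_newLabels_of_three_whole hA hdis hKB hne hR3 hb hst hsu hsv htu htv huv (whole hsv) (whole htv) hv

end Blowup

end Summit.CriticalPhenomena.PercolationContinuityZ3.Theorems.SahiColouredDaykin
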